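import Summits.CriticalPhenomena.PercolationContinuityZ3.Theorems.Transplant.FKConnectivityAllQArborealContraction
import Literature.Probability.Percolation.KozmaNitzanPreFKG
import HarnessLib

/-!
# The arboreal gas — forest-MM IS LOCAL STOCHASTIC MONOTONICITY; forest-MM ⇒ negative correlation of ADJACENT pairs and
# monotonicity of connection probabilities in the activities at the endpoints

Support file (`--supports stmt-CriticalPhenomena-4575`), FK sub-lane `prim-bschramm-fk-1` (gen 10) of the post-continuity programme;
builds on p205010 (kernel theorem, internal audit signed; external expert review pending).  No new definitions, no named facts, no
sorries; standard axioms.  `μ_w = agMeasure w` is the arboreal gas (weighted spanning forests, `P_w` conditioned on acyclicity,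
Grimmett (1.22)); `w[f ↦ c]` changes the parameter of the one pair `f`; `T_x` is the tree of `x`.

RESULTS (all for an arbitrary finite vertex type `V`; the node `ArborealClusterDomAdjOn V` = forest-MM of fk-1 g9 is the hypothesis
where it appears — it is conjectural, exact census 0 violations on `≤ 8` vertices):
* `arborealClusterDomAdjOn_iff_mono` — **forest-MM ⟺ local stochastic monotonicity**: forest-MM holds on `V` iff for every `w`, every
  pair `f = xz` at `x`, every up-set `𝒰` and parameters `a ≤ b` of `f`,
  `μ_{w[f↦a]}(T_x ∈ 𝒰)·μ_{w[f↦b]}(Ω) ≤ μ_{w[f↦b]}(T_x ∈ 𝒰)·μ_{w[f↦a]}(Ω)` — the law of the tree of `x` is stochastically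
  non-decreasing in the activity of each pair AT `x` (for pairs away from `x` this is false, fk-1 g7).  Mechanism: the weight sums are
  AFFINE in the parameter (`…ArborealContraction`), so `E_b M_a − E_a M_b = (b − a)·(S₁Z₀ − S₀Z₁)` and forest-MM is exactly `S₀Z₁ ≤ S₁Z₀`.
* `agMeasure_openConn_mono_of_clusterDomAdjOn` (+ `…_right`) — under forest-MM, **`μ_w(x ↔ y)/μ_w(Ω)` is non-decreasing in the activity
  of every pair at `x` or at `y`**.  Context: "negative correlation for all weights is equivalent to all connection probabilities being
  increasing in all weights" and "it remains open whether the arboreal gas is stochastically monotone in β" — forest-MM delivers the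
  monotonicity for the pairs at the two endpoints.
* `agMeasure_negCorr_adj_of_clusterDomAdjOn` — **forest-MM ⇒ negative correlation of adjacent pairs**: for `g = xy`, `f = xz` (`y ≠ z`),
  `μ(g, f ∈ F)·μ(Ω) ≤ μ(g ∈ F)·μ(f ∈ F)` — the adjacent case of the negative-correlation conjecture for the arboreal gas (open in
  general; uniform forests: Grimmett–Winkler), via the contraction identity: given `g ∈ F` the rest is the arboreal gas on `G − g`
  conditioned on `x ↮ y`, and forest-MM at `(w[g↦0], x, z, {S ∋ y})` is precisely `P(f | g) ≤ P(f | ¬g)`.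
[cite: BauerschmidtHelmuth2023, §5 eq. (5.5) and the paragraph following it (p. 28 of the EMS chapter)]
[cite: HalberstamHutchcroft2024, §1 p. 3 ("it remains open whether the arboreal gas is stochastically monotone in β")]
[cite: Grimmett2006, §1.5 eq. (1.22) (p. 13); §3.9 eq. (3.94), Conj. (3.96) (pp. 63–65)] [cite: AyyerLinussonRavichandran2025, §7 Conj. 7.1 (p. 22)]
-/

noncomputable section

namespace Summit.CriticalPhenomena.PercolationContinuityZ3.Theorems

namespace FK

open MeasureTheory Set Literature.Probability.LatticeModels Literature.Probability.Percolation
open Literature.Probability.Percolation.TwoAvoidanceSets (ind_mul_ind)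
open scoped Classical
open BHK2006 DecisionTree

variable {V : Type*} [Fintype V]

/-! ### Elementary algebra and bookkeeping -/

omit [Fintype V] in
/-- Two-point monotonicity: if `X₀Y₁ ≤ X₁Y₀` then `c ↦ (cX₁ + (1−c)X₀)/(cY₁ + (1−c)Y₀)` is non-decreasing (cross-multiplied form).
[folklore] -/
theorem affine_cross_le {X1 X0 Y1 Y0 a b : ℝ} (hab : a ≤ b) (h : X0 * Y1 ≤ X1 * Y0) :
    (a * X1 + (1 - a) * X0) * (b * Y1 + (1 - b) * Y0) ≤ (b * X1 + (1 - b) * X0) * (a * Y1 + (1 - a) * Y0) := by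
  nlinarith [mul_nonneg (sub_nonneg.2 hab) (sub_nonneg.2 h)]

/-- `μ_u(D) = (Σ_ω agWeight_u(ω)·1_D(ω)) / Z_u`. [cite: Grimmett2006, §1.5 eq. (1.22) (p. 13)] -/
theorem agMeasure_real_eq_sum_div (u : Sym2 V → unitInterval) (D : Set (BondConfig V)) :
    (agMeasure u).real D = (∑ ω : BondConfig V, agWeight u ω * ind D ω) / agPartition u := by
  rw [agMeasure_real_eq_agE, agE_eq_sum_div]

/-- `Σ_ω agWeight_u(ω)·1_Ω(ω) = Z_u`. [folklore] -/
theorem sum_agWeight_ind_univ (u : Sym2 V → unitInterval) :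
    ∑ ω : BondConfig V, agWeight u ω * ind (univ : Set (BondConfig V)) ω = agPartition u :=
  Finset.sum_congr rfl fun ω _ => by rw [ind_of_mem (Set.mem_univ _), mul_one]

/-- If `Z_u = 0` every `u`-weight vanishes. [folklore] -/
theorem agWeight_eq_zero_of_agPartition (u : Sym2 V → unitInterval) (hZ : agPartition u = 0) (ω : BondConfig V) :
    agWeight u ω = 0 :=
  (Finset.sum_eq_zero_iff_of_nonneg fun η _ => agWeight_nonneg u η).1 hZ ω (Finset.mem_univ ω)

/-- Weight sums against indicators are nonnegative. [folklore] -/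
theorem sum_agWeight_ind_nonneg (u : Sym2 V → unitInterval) (D : Set (BondConfig V)) :
    0 ≤ ∑ ω : BondConfig V, agWeight u ω * ind D ω :=
  Finset.sum_nonneg fun ω _ => mul_nonneg (agWeight_nonneg u ω) (ind_nonneg _ _)

omit [Fintype V] in
/-- Splitting an indicator along an event and its complement. [folklore] -/
theorem ind_eq_ind_inter_add (A D : Set (BondConfig V)) (ω : BondConfig V) :
    ind D ω = ind (A ∩ D) ω + ind (Aᶜ ∩ D) ω := by
  by_cases hA : ω ∈ A
  · by_cases hD : ω ∈ D
    · rw [ind_of_mem hD, ind_of_mem (show ω ∈ A ∩ D from ⟨hA, hD⟩),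
        ind_of_not_mem (show ω ∉ Aᶜ ∩ D from fun h => h.1 hA)]; ring
    · rw [ind_of_not_mem hD, ind_of_not_mem (show ω ∉ A ∩ D from fun h => hD h.2),
        ind_of_not_mem (show ω ∉ Aᶜ ∩ D from fun h => hD h.2)]; ring
  · by_cases hD : ω ∈ D
    · rw [ind_of_mem hD, ind_of_not_mem (show ω ∉ A ∩ D from fun h => hA h.1),
        ind_of_mem (show ω ∈ Aᶜ ∩ D from ⟨hA, hD⟩)]; ring
    · rw [ind_of_not_mem hD, ind_of_not_mem (show ω ∉ A ∩ D from fun h => hD h.2),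
        ind_of_not_mem (show ω ∉ Aᶜ ∩ D from fun h => hD h.2)]; ring

/-! ### forest-MM as the cross inequality `S₀Z₁ ≤ S₁Z₀` -/

/-- **forest-MM ⇒ the unnormalised cross inequality**: `S₀·Z₁ ≤ S₁·Z₀`, where `S_b = Σ_ω agWeight_{w[f↦b]}(ω)·1{T_x ∈ 𝒰}` and
`Z_b = Z_{w[f↦b]}`, `f = s(x,z)` — forest-MM applied at the half-parameter vector `w[f ↦ ½]`, whose weight sums are the averages of the
two revealed ones. [cite: Grimmett2006, §1.5 eq. (1.22) (p. 13); Thm. (3.7) (p. 39)] -/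
theorem sum_cross_le_of_clusterDomAdjOn (hMM : ArborealClusterDomAdjOn V) (w : Sym2 V → unitInterval) (x z : V)
    {𝒰 : Set (Set V)} (h𝒰 : IsUpperSet 𝒰) :
    (∑ ω : BondConfig V, agWeight (setW w s(x, z) false) ω * ind (clusterIn x 𝒰) ω) * agPartition (setW w s(x, z) true) ≤
      (∑ ω : BondConfig V, agWeight (setW w s(x, z) true) ω * ind (clusterIn x 𝒰) ω) * agPartition (setW w s(x, z) false) := by
  set S1 := ∑ ω : BondConfig V, agWeight (setW w s(x, z) true) ω * ind (clusterIn x 𝒰) ω with hS1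
  set S0 := ∑ ω : BondConfig V, agWeight (setW w s(x, z) false) ω * ind (clusterIn x 𝒰) ω with hS0
  set Z1 := agPartition (setW w s(x, z) true) with hZ1
  set Z0 := agPartition (setW w s(x, z) false) with hZ0
  have hZ1n : 0 ≤ Z1 := agPartition_nonneg _
  have hZ0n : 0 ≤ Z0 := agPartition_nonneg _
  let c : unitInterval := ⟨1 / 2, by norm_num, by norm_num⟩
  have hc : ((c : unitInterval) : ℝ) = 1 / 2 := rfl
  set w' := Function.update w s(x, z) c with hw'
  have hT : ∑ ω : BondConfig V, agWeight w' ω * ind (clusterIn x 𝒰) ω = (c : ℝ) * S1 + (1 - (c : ℝ)) * S0 :=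
    sum_agWeight_update_eq w s(x, z) c _
  have hJ : ∑ ω : BondConfig V, agWeight w' ω * ind {ω : BondConfig V | s(x, z) ∈ ω} ω = (c : ℝ) * Z1 := by
    have h := sum_agWeight_update_ind_mem_eq w s(x, z) c (fun _ => (1 : ℝ))
    simp only [mul_one] at h
    exact h
  have hU : ∑ ω : BondConfig V, agWeight w' ω * ind (univ : Set (BondConfig V)) ω = (c : ℝ) * Z1 + (1 - (c : ℝ)) * Z0 := by
    rw [sum_agWeight_ind_univ]; exact agPartition_update_eq w s(x, z) c
  have hTJ : ∑ ω : BondConfig V, agWeight w' ω * ind (clusterIn x 𝒰 ∩ {ω : BondConfig V | s(x, z) ∈ ω}) ω = (c : ℝ) * S1 := by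
    have h := sum_agWeight_update_ind_mem_eq w s(x, z) c (ind (clusterIn x 𝒰))
    rw [← h]
    refine Finset.sum_congr rfl fun ω _ => ?_
    rw [ind_mul_ind, Set.inter_comm]
  have hZ' : agPartition w' = (c : ℝ) * Z1 + (1 - (c : ℝ)) * Z0 := agPartition_update_eq w s(x, z) c
  have hnode := hMM w' x z 𝒰 h𝒰
  rw [agMeasure_real_eq_sum_div, agMeasure_real_eq_sum_div, agMeasure_real_eq_sum_div, agMeasure_real_eq_sum_div,
    hT, hJ, hU, hTJ, hZ', hc] at hnode
  by_cases hZ : (1 / 2 : ℝ) * Z1 + (1 - 1 / 2) * Z0 = 0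
  · have h1 : Z1 = 0 := by linarith
    have h0 : Z0 = 0 := by linarith
    rw [h1, h0, mul_zero, mul_zero]
  · have hpos : 0 < (1 / 2 : ℝ) * Z1 + (1 - 1 / 2) * Z0 := lt_of_le_of_ne (by linarith) (Ne.symm hZ)
    rw [div_mul_div_comm, div_mul_div_comm, div_le_div_iff_of_pos_right (mul_pos hpos hpos)] at hnode
    nlinarith [hnode]

/-- **The cross inequality ⇒ forest-MM** (converse): if `S₀Z₁ ≤ S₁Z₀` for all `w, x, z, 𝒰`, then forest-MM holds on `V` — at a
general `w` with `c = w(f)` the weight sums are `cS₁ + (1−c)S₀`, `cZ₁`, `cZ₁ + (1−c)Z₀`, `cS₁`, and the node inequality is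
`c(1−c)(S₀Z₁ − S₁Z₀) ≤ 0`. [cite: Grimmett2006, §1.5 eq. (1.22) (p. 13); Thm. (3.7) (p. 39)] -/
theorem clusterDomAdjOn_of_sum_cross
    (hcross : ∀ (w : Sym2 V → unitInterval) (x z : V) (𝒰 : Set (Set V)), IsUpperSet 𝒰 →
      (∑ ω : BondConfig V, agWeight (setW w s(x, z) false) ω * ind (clusterIn x 𝒰) ω) * agPartition (setW w s(x, z) true) ≤
        (∑ ω : BondConfig V, agWeight (setW w s(x, z) true) ω * ind (clusterIn x 𝒰) ω) * agPartition (setW w s(x, z) false)) :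
    ArborealClusterDomAdjOn V := by
  intro w x z 𝒰 h𝒰
  set S1 := ∑ ω : BondConfig V, agWeight (setW w s(x, z) true) ω * ind (clusterIn x 𝒰) ω with hS1
  set S0 := ∑ ω : BondConfig V, agWeight (setW w s(x, z) false) ω * ind (clusterIn x 𝒰) ω with hS0
  set Z1 := agPartition (setW w s(x, z) true) with hZ1
  set Z0 := agPartition (setW w s(x, z) false) with hZ0
  have key : S0 * Z1 ≤ S1 * Z0 := hcross w x z 𝒰 h𝒰
  set c := w s(x, z) with hcdef
  have hw : Function.update w s(x, z) c = w := Function.update_eq_self _ w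
  have hc0 : 0 ≤ (c : ℝ) := (w s(x, z)).2.1
  have hc1 : (c : ℝ) ≤ 1 := (w s(x, z)).2.2
  have hT : ∑ ω : BondConfig V, agWeight w ω * ind (clusterIn x 𝒰) ω = (c : ℝ) * S1 + (1 - (c : ℝ)) * S0 := by
    have h := sum_agWeight_update_eq w s(x, z) c (ind (clusterIn x 𝒰)); rwa [hw] at h
  have hJ : ∑ ω : BondConfig V, agWeight w ω * ind {ω : BondConfig V | s(x, z) ∈ ω} ω = (c : ℝ) * Z1 := by
    have h := sum_agWeight_update_ind_mem_eq w s(x, z) c (fun _ => (1 : ℝ))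
    rw [hw] at h; simp only [mul_one] at h
    exact h
  have hZ : agPartition w = (c : ℝ) * Z1 + (1 - (c : ℝ)) * Z0 := by
    have h := agPartition_update_eq w s(x, z) c; rwa [hw] at h
  have hTJ : ∑ ω : BondConfig V, agWeight w ω * ind (clusterIn x 𝒰 ∩ {ω : BondConfig V | s(x, z) ∈ ω}) ω = (c : ℝ) * S1 := by
    have h := sum_agWeight_update_ind_mem_eq w s(x, z) c (ind (clusterIn x 𝒰))
    rw [hw] at h; rw [← h]
    refine Finset.sum_congr rfl fun ω _ => ?_
    rw [ind_mul_ind, Set.inter_comm]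
  rw [agMeasure_real_eq_sum_div, agMeasure_real_eq_sum_div, agMeasure_real_eq_sum_div, agMeasure_real_eq_sum_div,
    sum_agWeight_ind_univ, hT, hJ, hTJ, hZ]
  by_cases hZw : (c : ℝ) * Z1 + (1 - (c : ℝ)) * Z0 = 0
  · rw [hZw]; simp
  · have hpos : 0 < (c : ℝ) * Z1 + (1 - (c : ℝ)) * Z0 :=
      lt_of_le_of_ne (by nlinarith [agPartition_nonneg (setW w s(x, z) true), agPartition_nonneg (setW w s(x, z) false)])
        (Ne.symm hZw)
    rw [div_mul_div_comm, div_mul_div_comm]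
    refine div_le_div_of_nonneg_right ?_ (mul_pos hpos hpos).le
    nlinarith [mul_nonneg (mul_nonneg hc0 (sub_nonneg.2 hc1)) (sub_nonneg.2 key)]

/-! ### forest-MM ⟺ local stochastic monotonicity -/

/-- **forest-MM ⇒ the law of `T_x` is stochastically non-decreasing in the parameter of each pair at `x`**: for `a ≤ b`,
`μ_{w[f↦a]}(T_x ∈ 𝒰)·μ_{w[f↦b]}(Ω) ≤ μ_{w[f↦b]}(T_x ∈ 𝒰)·μ_{w[f↦a]}(Ω)` (`f = s(x,z)`, `𝒰` an up-set; homogeneous form — when both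
measures are probability measures it reads `μ_{w[f↦a]}(T_x ∈ 𝒰) ≤ μ_{w[f↦b]}(T_x ∈ 𝒰)`).
[cite: HalberstamHutchcroft2024, §1 p. 3] [cite: Grimmett2006, §1.5 eq. (1.22) (p. 13)] -/
theorem agMeasure_clusterIn_mono_of_clusterDomAdjOn (hMM : ArborealClusterDomAdjOn V) (w : Sym2 V → unitInterval) (x z : V)
    {𝒰 : Set (Set V)} (h𝒰 : IsUpperSet 𝒰) {a b : unitInterval} (hab : a ≤ b) :
    (agMeasure (Function.update w s(x, z) a)).real (clusterIn x 𝒰) * (agMeasure (Function.update w s(x, z) b)).real univ ≤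
      (agMeasure (Function.update w s(x, z) b)).real (clusterIn x 𝒰) * (agMeasure (Function.update w s(x, z) a)).real univ := by
  set S1 := ∑ ω : BondConfig V, agWeight (setW w s(x, z) true) ω * ind (clusterIn x 𝒰) ω with hS1
  set S0 := ∑ ω : BondConfig V, agWeight (setW w s(x, z) false) ω * ind (clusterIn x 𝒰) ω with hS0
  set Z1 := agPartition (setW w s(x, z) true) with hZ1
  set Z0 := agPartition (setW w s(x, z) false) with hZ0
  have key : S0 * Z1 ≤ S1 * Z0 := sum_cross_le_of_clusterDomAdjOn hMM w x z h𝒰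
  have hab' : ((a : unitInterval) : ℝ) ≤ (b : ℝ) := hab
  rw [agMeasure_real_eq_sum_div, agMeasure_real_eq_sum_div, agMeasure_real_eq_sum_div, agMeasure_real_eq_sum_div,
    sum_agWeight_ind_univ, sum_agWeight_ind_univ, sum_agWeight_update_eq w s(x, z) a, sum_agWeight_update_eq w s(x, z) b,
    agPartition_update_eq w s(x, z) a, agPartition_update_eq w s(x, z) b]
  set Za := (a : ℝ) * Z1 + (1 - (a : ℝ)) * Z0 with hZa
  set Zb := (b : ℝ) * Z1 + (1 - (b : ℝ)) * Z0 with hZb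
  have hZan : 0 ≤ Za := by nlinarith [agPartition_nonneg (setW w s(x, z) true), agPartition_nonneg (setW w s(x, z) false), a.2.1, a.2.2]
  have hZbn : 0 ≤ Zb := by nlinarith [agPartition_nonneg (setW w s(x, z) true), agPartition_nonneg (setW w s(x, z) false), b.2.1, b.2.2]
  by_cases hza : Za = 0
  · rw [hza]; simp
  · by_cases hzb : Zb = 0
    · rw [hzb]; simp
    · have hpa : 0 < Za := lt_of_le_of_ne hZan (Ne.symm hza)
      have hpb : 0 < Zb := lt_of_le_of_ne hZbn (Ne.symm hzb)
      rw [div_self hza, div_self hzb, mul_one, mul_one, div_le_div_iff₀ hpa hpb]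
      exact affine_cross_le hab' key

/-- **Local stochastic monotonicity ⇒ forest-MM** (converse; the case `a = 0`, `b = 1` already suffices).
[cite: Grimmett2006, §1.5 eq. (1.22) (p. 13)] -/
theorem clusterDomAdjOn_of_mono
    (hmono : ∀ (w : Sym2 V → unitInterval) (x z : V) (𝒰 : Set (Set V)), IsUpperSet 𝒰 → ∀ a b : unitInterval, a ≤ b →
      (agMeasure (Function.update w s(x, z) a)).real (clusterIn x 𝒰) * (agMeasure (Function.update w s(x, z) b)).real univ ≤
        (agMeasure (Function.update w s(x, z) b)).real (clusterIn x 𝒰) * (agMeasure (Function.update w s(x, z) a)).real univ) :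
    ArborealClusterDomAdjOn V := by
  refine clusterDomAdjOn_of_sum_cross fun w x z 𝒰 h𝒰 => ?_
  set S1 := ∑ ω : BondConfig V, agWeight (setW w s(x, z) true) ω * ind (clusterIn x 𝒰) ω with hS1
  set S0 := ∑ ω : BondConfig V, agWeight (setW w s(x, z) false) ω * ind (clusterIn x 𝒰) ω with hS0
  set Z1 := agPartition (setW w s(x, z) true) with hZ1
  set Z0 := agPartition (setW w s(x, z) false) with hZ0
  have h01 : (0 : unitInterval) ≤ 1 := zero_le_one
  have h := hmono w x z 𝒰 h𝒰 0 1 h01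
  rw [← setW_false_eq, ← setW_true_eq, agMeasure_real_eq_sum_div, agMeasure_real_eq_sum_div, agMeasure_real_eq_sum_div,
    agMeasure_real_eq_sum_div, sum_agWeight_ind_univ, sum_agWeight_ind_univ] at h
  have hZ1n : 0 ≤ Z1 := agPartition_nonneg _
  have hZ0n : 0 ≤ Z0 := agPartition_nonneg _
  have hS1n : 0 ≤ S1 := sum_agWeight_ind_nonneg _ _
  by_cases hz0 : Z0 = 0
  · have hS0 : S0 = 0 := Finset.sum_eq_zero fun ω _ => by rw [agWeight_eq_zero_of_agPartition _ hz0 ω, zero_mul]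
    rw [hS0, zero_mul]; exact mul_nonneg hS1n hZ0n
  · by_cases hz1 : Z1 = 0
    · rw [hz1, mul_zero]; exact mul_nonneg hS1n hZ0n
    · have hp0 : 0 < Z0 := lt_of_le_of_ne hZ0n (Ne.symm hz0)
      have hp1 : 0 < Z1 := lt_of_le_of_ne hZ1n (Ne.symm hz1)
      rw [div_self hz0, div_self hz1, mul_one, mul_one, div_le_div_iff₀ hp0 hp1] at h
      exact h

/-- **forest-MM ⟺ local stochastic monotonicity of the arboreal gas**: the node `ArborealClusterDomAdjOn V` holds iff for every
weight vector, every pair `f = xz` at `x`, every up-set `𝒰` of vertex sets and parameters `a ≤ b` of `f`,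
`μ_{w[f↦a]}(T_x ∈ 𝒰)·μ_{w[f↦b]}(Ω) ≤ μ_{w[f↦b]}(T_x ∈ 𝒰)·μ_{w[f↦a]}(Ω)`.
[cite: HalberstamHutchcroft2024, §1 p. 3] [cite: BauerschmidtHelmuth2023, §5 (p. 28)] [cite: Grimmett2006, §1.5 eq. (1.22) (p. 13)] -/
theorem arborealClusterDomAdjOn_iff_mono :
    ArborealClusterDomAdjOn V ↔
      ∀ (w : Sym2 V → unitInterval) (x z : V) (𝒰 : Set (Set V)), IsUpperSet 𝒰 → ∀ a b : unitInterval, a ≤ b →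
        (agMeasure (Function.update w s(x, z) a)).real (clusterIn x 𝒰) * (agMeasure (Function.update w s(x, z) b)).real univ ≤
          (agMeasure (Function.update w s(x, z) b)).real (clusterIn x 𝒰) * (agMeasure (Function.update w s(x, z) a)).real univ :=
  ⟨fun h w x z _ h𝒰 _ _ hab => agMeasure_clusterIn_mono_of_clusterDomAdjOn h w x z h𝒰 hab, clusterDomAdjOn_of_mono⟩

/-! ### Monotonicity of connection probabilities in the activities at the endpoints -/

/-- **forest-MM ⇒ `μ(x ↔ y)` is non-decreasing in the activity of a pair at `x`**: for `f = s(x,z)` and `a ≤ b`,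
`μ_{w[f↦a]}(x ↔ y)·μ_{w[f↦b]}(Ω) ≤ μ_{w[f↦b]}(x ↔ y)·μ_{w[f↦a]}(Ω)`.
[cite: BauerschmidtHelmuth2023, §5 (p. 28)] [cite: HalberstamHutchcroft2024, §1 p. 3] -/
theorem agMeasure_openConn_mono_of_clusterDomAdjOn (hMM : ArborealClusterDomAdjOn V) (w : Sym2 V → unitInterval) (x y z : V)
    {a b : unitInterval} (hab : a ≤ b) :
    (agMeasure (Function.update w s(x, z) a)).real (openConn x y) * (agMeasure (Function.update w s(x, z) b)).real univ ≤
      (agMeasure (Function.update w s(x, z) b)).real (openConn x y) * (agMeasure (Function.update w s(x, z) a)).real univ := by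
  rw [← clusterIn_mem_eq_openConn]
  exact agMeasure_clusterIn_mono_of_clusterDomAdjOn hMM w x z (SoloBlindKN.isUpperSet_containing y) hab

/-- **… and in the activity of a pair at `y`** (`f = s(y,z)`), by the symmetry of `{x ↔ y}`.
[cite: BauerschmidtHelmuth2023, §5 (p. 28)] [cite: HalberstamHutchcroft2024, §1 p. 3] -/
theorem agMeasure_openConn_mono_right_of_clusterDomAdjOn (hMM : ArborealClusterDomAdjOn V) (w : Sym2 V → unitInterval)
    (x y z : V) {a b : unitInterval} (hab : a ≤ b) :
    (agMeasure (Function.update w s(y, z) a)).real (openConn x y) * (agMeasure (Function.update w s(y, z) b)).real univ ≤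
      (agMeasure (Function.update w s(y, z) b)).real (openConn x y) * (agMeasure (Function.update w s(y, z) a)).real univ := by
  rw [KNPreFKG.openConn_symm x y]
  exact agMeasure_openConn_mono_of_clusterDomAdjOn hMM w y x z hab

/-! ### forest-MM ⇒ negative correlation of adjacent pairs -/

/-- **The key comparison** behind adjacent negative correlation: for `g = s(x,y)` (`x ≠ y`) and `f = s(x,z)` (`y ≠ z`), forest-MM gives
`A₁·Z₀ ≤ Z₁·A₀` with `A_b = Σ_ω agWeight_{w[g↦b]}·1{f ∈ ω}`, `Z_b = Z_{w[g↦b]}` — i.e. `P(f ∈ F | g ∈ F) ≤ P(f ∈ F | g ∉ F)`.  By the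
contraction identity `A₁ = Σ agWeight_{w[g↦0]}·1{x ↮ y, f ∈ ω}` and `Z₁ = Σ agWeight_{w[g↦0]}·1{x ↮ y}`, and the claim is forest-MM at
`(w[g↦0], x, z, {S ∋ y})`. [cite: Grimmett2006, Thm. (3.1)(a) (p. 37); §3.9 eq. (3.94) (p. 63)] -/
theorem sum_mem_cross_le_of_clusterDomAdjOn (hMM : ArborealClusterDomAdjOn V) (w : Sym2 V → unitInterval) {x y z : V}
    (hxy : x ≠ y) (hyz : y ≠ z) :
    (∑ ω : BondConfig V, agWeight (setW w s(x, y) true) ω * ind {ω : BondConfig V | s(x, z) ∈ ω} ω) *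
        agPartition (setW w s(x, y) false) ≤
      agPartition (setW w s(x, y) true) *
        ∑ ω : BondConfig V, agWeight (setW w s(x, y) false) ω * ind {ω : BondConfig V | s(x, z) ∈ ω} ω := by
  set u1 := setW w s(x, y) true with hu1
  set u0 := setW w s(x, y) false with hu0
  set Jf : Set (BondConfig V) := {ω | s(x, z) ∈ ω} with hJf
  set D : Set (BondConfig V) := openConn x y with hD
  have hfg : s(x, z) ≠ s(x, y) := by
    intro h
    rcases Sym2.eq_iff.1 h with ⟨-, h2⟩ | ⟨h1, -⟩
    · exact hyz h2.symm
    · exact hxy h1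
  have hins : ∀ ω : BondConfig V, ind Jf (insert s(x, y) ω) = ind Jf ω := by
    intro ω
    by_cases h : s(x, z) ∈ ω
    · rw [ind_of_mem (show insert s(x, y) ω ∈ Jf from Set.mem_insert_of_mem _ h), ind_of_mem (show ω ∈ Jf from h)]
    · have h' : insert s(x, y) ω ∉ Jf := by
        intro h'
        rcases (Set.mem_insert_iff.1 h') with e | e
        · exact hfg e
        · exact h e
      rw [ind_of_not_mem h', ind_of_not_mem (show ω ∉ Jf from h)]
  have hA1 : ∑ ω : BondConfig V, agWeight u1 ω * ind Jf ω = ∑ ω : BondConfig V, agWeight u0 ω * ind (Dᶜ ∩ Jf) ω := by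
    rw [hu1, sum_agWeight_setW_true_eq_sum_insert w hxy (ind Jf)]
    refine Finset.sum_congr rfl fun ω _ => ?_
    rw [hins ω, ind_mul_ind]
  have hZ1 : agPartition u1 = ∑ ω : BondConfig V, agWeight u0 ω * ind Dᶜ ω := agPartition_setW_true_eq w hxy
  have hsplitJ : ∑ ω : BondConfig V, agWeight u0 ω * ind Jf ω =
      ∑ ω : BondConfig V, agWeight u0 ω * ind (D ∩ Jf) ω + ∑ ω : BondConfig V, agWeight u0 ω * ind (Dᶜ ∩ Jf) ω := by
    rw [← Finset.sum_add_distrib]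
    exact Finset.sum_congr rfl fun ω _ => by rw [← mul_add, ← ind_eq_ind_inter_add]
  have hsplitZ : agPartition u0 = ∑ ω : BondConfig V, agWeight u0 ω * ind D ω + ∑ ω : BondConfig V, agWeight u0 ω * ind Dᶜ ω := by
    rw [← sum_agWeight_ind_univ u0, ← Finset.sum_add_distrib]
    refine Finset.sum_congr rfl fun ω _ => ?_
    rw [← mul_add, ind_eq_ind_inter_add D univ ω, Set.inter_univ, Set.inter_univ]
  -- forest-MM at (u0, x, z, {S ∋ y})
  have hnode := hMM u0 x z {S | y ∈ S} (SoloBlindKN.isUpperSet_containing y)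
  rw [clusterIn_mem_eq_openConn, agMeasure_real_eq_sum_div, agMeasure_real_eq_sum_div, agMeasure_real_eq_sum_div,
    agMeasure_real_eq_sum_div, sum_agWeight_ind_univ] at hnode
  by_cases hZ0 : agPartition u0 = 0
  · have hz : ∀ ω, agWeight u0 ω = 0 := agWeight_eq_zero_of_agPartition u0 hZ0
    have hZ1' : agPartition u1 = 0 := agPartition_setW_true_eq_zero_of_false w hxy hZ0
    rw [hZ0, hZ1', mul_zero, zero_mul]
  · have hZ0pos : 0 < agPartition u0 := lt_of_le_of_ne (agPartition_nonneg _) (Ne.symm hZ0)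
    rw [div_mul_div_comm, div_mul_div_comm, div_le_div_iff_of_pos_right (mul_pos hZ0pos hZ0pos)] at hnode
    rw [hA1, hZ1]
    rw [hsplitJ, hsplitZ] at hnode ⊢
    have hDJ : (D ∩ Jf : Set (BondConfig V)) = openConn x y ∩ {ω | s(x, z) ∈ ω} := rfl
    nlinarith [hnode, sum_agWeight_ind_nonneg u0 (D ∩ Jf), sum_agWeight_ind_nonneg u0 (Dᶜ ∩ Jf),
      sum_agWeight_ind_nonneg u0 D, sum_agWeight_ind_nonneg u0 Dᶜ]

/-- **forest-MM ⇒ negative correlation of ADJACENT pairs for the arboreal gas**: for `g = xy`, `f = xz` with `x ≠ y`, `y ≠ z` and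
every weight vector `w`, `μ_w(g ∈ F, f ∈ F)·μ_w(Ω) ≤ μ_w(g ∈ F)·μ_w(f ∈ F)` — the adjacent case of the negative-correlation conjecture
(5.5) for the arboreal gas (for uniform forests: Grimmett's Conj. (3.96)-type statement), CONDITIONAL on the node.  With `c = w(g)`
the four masses are `cA₁`, `cZ₁`, `cA₁ + (1−c)A₀`, `cZ₁ + (1−c)Z₀` and the claim is `c(1−c)(A₁Z₀ − Z₁A₀) ≤ 0`.
[cite: BauerschmidtHelmuth2023, §5 eq. (5.5) (p. 28)] [cite: Grimmett2006, §3.9 eq. (3.94), Conj. (3.96) (pp. 63–65)] -/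
theorem agMeasure_negCorr_adj_of_clusterDomAdjOn (hMM : ArborealClusterDomAdjOn V) (w : Sym2 V → unitInterval) {x y z : V}
    (hxy : x ≠ y) (hyz : y ≠ z) :
    (agMeasure w).real ({ω | s(x, y) ∈ ω} ∩ {ω | s(x, z) ∈ ω}) * (agMeasure w).real univ ≤
      (agMeasure w).real {ω | s(x, y) ∈ ω} * (agMeasure w).real {ω | s(x, z) ∈ ω} := by
  set u1 := setW w s(x, y) true with hu1
  set u0 := setW w s(x, y) false with hu0
  set A1 := ∑ ω : BondConfig V, agWeight u1 ω * ind {ω : BondConfig V | s(x, z) ∈ ω} ω with hA1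
  set A0 := ∑ ω : BondConfig V, agWeight u0 ω * ind {ω : BondConfig V | s(x, z) ∈ ω} ω with hA0
  set Z1 := agPartition u1 with hZ1
  set Z0 := agPartition u0 with hZ0
  have key : A1 * Z0 ≤ Z1 * A0 := sum_mem_cross_le_of_clusterDomAdjOn hMM w hxy hyz
  set c := w s(x, y) with hcdef
  have hw : Function.update w s(x, y) c = w := Function.update_eq_self _ w
  have hc0 : 0 ≤ (c : ℝ) := (w s(x, y)).2.1
  have hc1 : (c : ℝ) ≤ 1 := (w s(x, y)).2.2
  have hGF : ∑ ω : BondConfig V, agWeight w ω * ind ({ω : BondConfig V | s(x, y) ∈ ω} ∩ {ω | s(x, z) ∈ ω}) ω = (c : ℝ) * A1 := by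
    have h := sum_agWeight_update_ind_mem_eq w s(x, y) c (ind {ω : BondConfig V | s(x, z) ∈ ω})
    rw [hw] at h; rw [← h]
    exact Finset.sum_congr rfl fun ω _ => by rw [ind_mul_ind]
  have hG : ∑ ω : BondConfig V, agWeight w ω * ind {ω : BondConfig V | s(x, y) ∈ ω} ω = (c : ℝ) * Z1 := by
    have h := sum_agWeight_update_ind_mem_eq w s(x, y) c (fun _ => (1 : ℝ))
    rw [hw] at h; simp only [mul_one] at h
    exact h
  have hF : ∑ ω : BondConfig V, agWeight w ω * ind {ω : BondConfig V | s(x, z) ∈ ω} ω = (c : ℝ) * A1 + (1 - (c : ℝ)) * A0 := by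
    have h := sum_agWeight_update_eq w s(x, y) c (ind {ω : BondConfig V | s(x, z) ∈ ω}); rwa [hw] at h
  have hZ : agPartition w = (c : ℝ) * Z1 + (1 - (c : ℝ)) * Z0 := by
    have h := agPartition_update_eq w s(x, y) c; rwa [hw] at h
  rw [agMeasure_real_eq_sum_div, agMeasure_real_eq_sum_div, agMeasure_real_eq_sum_div, agMeasure_real_eq_sum_div,
    sum_agWeight_ind_univ, hGF, hG, hF, hZ]
  by_cases hZw : (c : ℝ) * Z1 + (1 - (c : ℝ)) * Z0 = 0
  · rw [hZw]; simp
  · have hpos : 0 < (c : ℝ) * Z1 + (1 - (c : ℝ)) * Z0 :=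
      lt_of_le_of_ne (by nlinarith [agPartition_nonneg u1, agPartition_nonneg u0]) (Ne.symm hZw)
    rw [div_mul_div_comm, div_mul_div_comm]
    refine div_le_div_of_nonneg_right ?_ (mul_pos hpos hpos).le
    nlinarith [mul_nonneg (mul_nonneg hc0 (sub_nonneg.2 hc1)) (sub_nonneg.2 key)]

/-! ### Node-level corollaries -/

/-- **`ArborealClusterDomAdjPos` ⇒ adjacent-pair negative correlation of the arboreal gas on every finite weighted graph.**
[cite: BauerschmidtHelmuth2023, §5 eq. (5.5) (p. 28)] [cite: AyyerLinussonRavichandran2025, §7 Conj. 7.1 (p. 22)] -/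
theorem arborealNegCorrAdj_of_clusterDomAdjPos (h : ArborealClusterDomAdjPos) (n : ℕ) (w : Sym2 (Fin n) → unitInterval)
    {x y z : Fin n} (hxy : x ≠ y) (hyz : y ≠ z) :
    (agMeasure w).real ({ω | s(x, y) ∈ ω} ∩ {ω | s(x, z) ∈ ω}) * (agMeasure w).real univ ≤
      (agMeasure w).real {ω | s(x, y) ∈ ω} * (agMeasure w).real {ω | s(x, z) ∈ ω} :=
  agMeasure_negCorr_adj_of_clusterDomAdjOn (h n) w hxy hyz

/-- **`ArborealClusterDomAdjPos` ⇒ connection probabilities of the arboreal gas are non-decreasing in the activities of the pairs at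
the endpoints, on every finite weighted graph.** [cite: BauerschmidtHelmuth2023, §5 (p. 28)] [cite: HalberstamHutchcroft2024, §1 p. 3] -/
theorem arborealConnMono_of_clusterDomAdjPos (h : ArborealClusterDomAdjPos) (n : ℕ) (w : Sym2 (Fin n) → unitInterval)
    (x y z : Fin n) {a b : unitInterval} (hab : a ≤ b) :
    (agMeasure (Function.update w s(x, z) a)).real (openConn x y) * (agMeasure (Function.update w s(x, z) b)).real univ ≤
      (agMeasure (Function.update w s(x, z) b)).real (openConn x y) * (agMeasure (Function.update w s(x, z) a)).real univ :=
  by convert agMeasure_openConn_mono_of_clusterDomAdjOn (h n) w x y z hab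

end FK

end Summit.CriticalPhenomena.PercolationContinuityZ3.Theorems

end
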